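import Summits.QuantumFields.YangMills.Theorems.BalabanUVNodesK0SingleBondWalks
import Literature.MathematicalPhysics.QuantumFieldTheory.Balaban1983to89.BlockAveragingEMLAnalyticMean

/-!
# K0⁗ ROW P11 — the impulse response of Bałaban's (0.4) averaging to one twisted bond, part B: THE LOOP VARIABLES AT `c⋆` AND `exp[mean log]` OF A TWO-VALUED FAMILY

Cell `pub-ymgap`, seat `pub-ymgap-dag-n21-c` g7 (R134 (a) N21 NE7c s1; K0⁗ ROW P11 negative side; INBOX INTENT-2 of 2026-08-27 ≈07:40Z; dag-n07-e g7 l.17651 «NO STOP —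
19b uses ONLY the crude global bound … your sharp `dist1_avgFun_singleBond_le` is NEW and needed»).  Filed `--kind proof --supports stmt-QuantumFields-20289 --as helper`.
[15] = [Balaban1985Variational]; [I] = [Balaban1987RG1]; [III] = [Balaban1988Convergent]; [B7] = [Balaban1985Averaging].

THE SERIES (four modules, one namespace `…Theorems.K0AveragedSingleBondFloor`): (A) `…K0SingleBondWalks` — walk bookkeeping and «Ū = 1 by avoidance ∕ by locality»;
(B) `…K0SingleBondStarLoops` — the loop variables of [I] (0.4) at the one coarse bond `c⋆` the twisted fine bond crosses, and the printed `exp[mean log]` of a two-valued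
family; (C) `…K0SingleBondResponse` — THE IMPULSE RESPONSE of Bałaban's (0.4) averaging of record (`avOfRecord = blockAvg expMeanLogSU`) to ONE twisted fine bond:
`|Ū(c⋆) − 1| ≤ exp(−log(1−t)∕L^{d−1}) − 1 ≤ 4t∕L³`, `Ū(c) = 1` for every other coarse bond; (D) `…K0AveragedSingleBondFloor` — ★★ THE FLOOR OF RECORD for node00-def-P11's
FILE 8 v1.3 fact: `VariationalThm1RegSepPrinted F N B₃ a₀ a₁ → 2L² ≤ B₃` (every `N ≥ 2`, `a₀, a₁ > 0`), unconditionally (existence by dag-n07-e 19a's small-action boundary avoidance).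
HONEST FRAMING: kernel bookkeeping about the TREE's own averaging and one certificate about a TREE-typed fact; nothing of Bałaban asserted or refuted (print: `B₃ = B₃(d, L)`;
node00-def-K0a displays `2L² ≤ B₃`); K0⁗ neither discharged nor refuted; counts unmoved; no `def`, no `sorry`, no `instance`.

THIS MODULE (B).  §3 at the coarse bond `c⋆ = ⟨y₁, μ₀⟩` whose block interface the twisted bond `⟨x′, μ₀⟩` crosses at the lowest transverse corner
(`x′_{μ₀} = emb y₁ _{μ₀} + h`, `x′_κ + h = emb y₁ _κ`), the loop `Γ ∪ [x,x′′] ∪ (−Γ′) ∪ (−c⋆)` of index `(r, σ, σ′)` ([I] (0.4)) has `U₁`-holonomy `g` iff `r_κ = 0` for all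
`κ ≠ μ₀` (its transported segment runs on the bond's axis) and `1` otherwise; the straight transporter `U(c⋆)` is `1` (`loopHol_single_star`, `axialAvg_single_star`).
§4 for the printed inner operation on `SU(N)` (`ExpMeanLog.expMeanLogSU`): a family equal to `1` off an index set `S` and in `{1, g}` on it, `|g − 1| ≤ t < δ_N`, `t < 1`,
averages to within `exp((|S|∕|I|)·(−log(1−t))) − 1` of `1` (`dist1_avg_expMeanLogSU_le`; series log (26) of [B7], `‖e^Z − 1‖ ≤ e^{‖Z‖} − 1`).
DEPENDENCES (by name): part A; p476836 `BlockAveragingEMLProp2.walkEnd_stairWord_apply`; `BlockAveraging.(stairWord, wordRev, netDisp_stairWord, netDisp_take_stairWord, netDisp_take_wordRev, netDisp_wordRev, walk_append, holAt_append)`,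
`AveragingRT.two_mul_half_add_one`, `ExpMeanLog.(expMeanLogSU, deltaSU, deltaSU_pos)`, `LoopAverage.(avg, enum)`, `BlockAveragingEMLAnalyticMean.(coe_expMeanLogSU_E_eq_eml,
eml_eq_exp_meanCLM)`, `B7TransferAnalyticMean.(meanCLM_apply, norm_exp_sub_one_le)`, `MatrixLog.(mlog_one, norm_mlog_le_neg_log)`.
-/

noncomputable section

open scoped Matrix.Norms.L2Operator

namespace Summit.QuantumFields.YangMills.Theorems.K0AveragedSingleBondFloor

open Literature.MathematicalPhysics.QuantumFieldTheory.Balaban1983to89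
open Literature.MathematicalPhysics.QuantumFieldTheory.Balaban1983to89.Node00
open Literature.MathematicalPhysics.QuantumFieldTheory.Balaban1983to89.T4Continuum
open B15DeterminingSets BlockAveraging
open Literature.MathematicalPhysics.QuantumFieldTheory.Balaban1983to89.T3DescentFibreTower (holAt_one axialAvg_one avgFun_one
  expMeanLogSU_E_one loopHol_one small_one)
/-! ## §3  The coarse bond `c⋆ = ⟨y₁, μ₀⟩` whose block interface the twisted bond crosses: its `L^d·(d!)²` loop variables are `g` on the
`L·(d!)²` indices whose transverse offsets sit on the axis of the twisted bond and `1` otherwise; its straight transporter is `1` -/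
section Star

variable {P : Params} {j : ℕ} {G : Type*} [GaugeGroup G]

/-- **THE LOOP VARIABLES OF (0.4) AT `c⋆ = ⟨y₁, μ₀⟩` IN THE SINGLE-BOND CONFIGURATION** twisted at the bond `⟨x′, μ₀⟩` with `x′` the lowest transverse corner of
the far face of `B(y₁)` in direction `μ₀` (`x′_{μ₀} = emb y₁ _{μ₀} + h`, `x′_κ + h = emb y₁ _κ` for `κ ≠ μ₀`): the loop `Γ ∪ [x,x′′] ∪ (−Γ′) ∪ (−c⋆)` of index
`(r, σ, σ′)` reads the twisted bond exactly when its point `x = emb y₁ + n` (`n = r − h`) lies on the axis of the bond (`r_κ = 0` for all `κ ≠ μ₀`) — then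
through its segment `[x, x′′]`, once, forward: value `g` — and misses it otherwise: value `1` (the staircases stay in their blocks, whose `μ₀`-ranges exclude
the bond's far end resp. its source; `−c⋆` runs on the central axis, off the corner axis since `h ≥ 1`; `d ≥ 2`, torus longer than `2L`).
[cite: Balaban1987RG1, (0.3)–(0.4) pp.252–253 (bookkeeping)] -/
theorem loopHol_single_star (hper : 2 * P.L < P.sitesPerDir j) (hL : 3 ≤ P.L) {κ₁ μ0 : Fin P.d} (hκ₁ : κ₁ ≠ μ0) (y₁ : Site P (j + 1))
    (x' : Site P j) (g : G) (hx0 : x' μ0 = emb y₁ μ0 + (((P.L - 1) / 2 : ℕ) : ZMod (P.sitesPerDir j)))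
    (hxκ : ∀ κ, κ ≠ μ0 → x' κ + (((P.L - 1) / 2 : ℕ) : ZMod (P.sitesPerDir j)) = emb y₁ κ) (i : Idx P) :
    loopHol (fun b : PBond P j => if b.src = x' ∧ b.dir = μ0 then g else 1) ⟨y₁, μ0⟩ i =
      if (∀ κ, κ ≠ μ0 → (i.1 κ : ℕ) = 0) then g else 1 := by
  classical
  set U : GaugeField P j G := fun b => if b.src = x' ∧ b.dir = μ0 then g else 1 with hU
  set h : ℕ := (P.L - 1) / 2 with hh
  have hL2 : 2 * h + 1 = P.L := AveragingRT.two_mul_half_add_one P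
  obtain ⟨r, σ, σ'⟩ := i
  set n : Fin P.d → ℤ := off r with hn
  have hnb : ∀ κ, -(h : ℤ) ≤ n κ ∧ n κ ≤ h := fun κ => off_bounds r κ
  -- the four pieces
  unfold loopHol
  simp only [loopWord]
  rw [walk_append, holAt_append, walk_append, holAt_append, walk_append, holAt_append]
  -- starts of the pieces
  set x : Site P j := walkEnd (emb y₁) (stairWord σ n) with hxdef
  have hx : ∀ κ, x κ = emb y₁ κ + ((n κ : ℤ) : ZMod (P.sitesPerDir j)) := fun κ => BlockAveragingEMLProp2.walkEnd_stairWord_apply (emb y₁) σ n κ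
  set x2 : Site P j := walkEnd x (List.replicate P.L (μ0, true)) with hx2def
  have hx2 : ∀ κ, x2 κ = x κ + (if μ0 = κ then (P.L : ZMod (P.sitesPerDir j)) else 0) := by
    intro κ
    have := walkEnd_take_replicate_apply x μ0 P.L P.L κ
    rw [List.take_of_length_le (by rw [List.length_replicate]), min_self] at this
    rw [hx2def, this]
  set x3 : Site P j := walkEnd x2 (wordRev (stairWord σ' n)) with hx3def
  have hx3 : ∀ κ, x3 κ = x2 κ - ((n κ : ℤ) : ZMod (P.sitesPerDir j)) := by
    intro κ; rw [hx3def, walkEnd_apply, netDisp_wordRev, netDisp_stairWord, Int.cast_neg, sub_eq_add_neg]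
  -- piece 1: the staircase `Γ` from `emb y₁` never visits `x′ + e_{μ₀}` (coordinate `μ₀`)
  have H1 : holAt U (walk (emb y₁) (stairWord σ n)) = 1 := by
    refine holAt_single_eq_one_of_ne_tgt x' μ0 g _ _ (fun k heq => ?_)
    have hc := congrFun heq μ0
    rw [walkEnd_apply, Site.shift_apply, if_pos rfl, hx0] at hc
    have hb := netDisp_take_stairWord σ n μ0 k
    generalize netDisp ((stairWord σ n).take k) μ0 = e at hc hb
    have hc' : (((e : ℤ) - h - 1 : ℤ) : ZMod (P.sitesPerDir j)) = 0 := by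
      have := sub_eq_zero.mpr hc; push_cast at this ⊢; linear_combination this
    have hb' := hnb μ0
    have hne : ((e : ℤ) - h - 1 : ℤ) ≠ 0 := by
      rcases le_total 0 (n μ0) with h0 | h0
      · rw [min_eq_left h0, max_eq_right h0] at hb; omega
      · rw [min_eq_right h0, max_eq_left h0] at hb; omega
    have hlt : (((e : ℤ) - h - 1 : ℤ)).natAbs < P.sitesPerDir j := by
      rcases le_total 0 (n μ0) with h0 | h0
      · rw [min_eq_left h0, max_eq_right h0] at hb; omega
      · rw [min_eq_right h0, max_eq_left h0] at hb; omega
    exact intCast_ne_zero_of_natAbs_lt hne hlt hc'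
  -- piece 3: the reversed staircase `−Γ′` from `x′′ = x + L e_{μ₀}` never visits `x′` (coordinate `μ₀`)
  have H3 : holAt U (walk x2 (wordRev (stairWord σ' n))) = 1 := by
    refine holAt_single_eq_one_of_ne_src x' μ0 g _ _ (fun k heq => ?_)
    have hc := congrFun heq μ0
    obtain ⟨m, hm⟩ := netDisp_take_wordRev (stairWord σ' n) k
    rw [walkEnd_apply, hm μ0, netDisp_stairWord, hx2, if_pos rfl, hx, hx0] at hc
    have hb := netDisp_take_stairWord σ' n μ0 m
    generalize netDisp ((stairWord σ' n).take m) μ0 = e at hc hb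
    have hc' : (((e : ℤ) + (2 * h + 1 : ℕ) - h : ℤ) : ZMod (P.sitesPerDir j)) = 0 := by
      rw [hL2]
      have := sub_eq_zero.mpr hc; push_cast at this ⊢; linear_combination this
    have hb' := hnb μ0
    have hne : ((e : ℤ) + (2 * h + 1 : ℕ) - h : ℤ) ≠ 0 := by
      rcases le_total 0 (n μ0) with h0 | h0
      · rw [min_eq_left h0, max_eq_right h0] at hb; push_cast; omega
      · rw [min_eq_right h0, max_eq_left h0] at hb; push_cast; omega
    have hlt : (((e : ℤ) + (2 * h + 1 : ℕ) - h : ℤ)).natAbs < P.sitesPerDir j := by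
      rcases le_total 0 (n μ0) with h0 | h0
      · rw [min_eq_left h0, max_eq_right h0] at hb; push_cast; omega
      · rw [min_eq_right h0, max_eq_left h0] at hb; push_cast; omega
    exact intCast_ne_zero_of_natAbs_lt hne hlt hc'
  -- piece 4: the central axis `−c⋆` from `emb (y₁ + e_{μ₀})` never visits `x′ + e_{μ₀}` (transverse coordinate `κ₁`)
  have H4 : holAt U (walk x3 (List.replicate P.L (μ0, false))) = 1 := by
    refine holAt_single_eq_one_of_ne_tgt x' μ0 g _ _ (fun k heq => ?_)
    have hc := congrFun heq κ₁
    rw [walkEnd_take_replicate_false_apply, if_neg (Ne.symm hκ₁), sub_zero, hx3, hx2, if_neg (Ne.symm hκ₁), add_zero, hx,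
      Site.shift_apply, if_neg hκ₁, ← hxκ κ₁ hκ₁] at hc
    -- `emb y₁ κ₁ + n κ₁ - n κ₁ = emb y₁ κ₁ - h`, i.e. `h = 0` mod the period
    have hc' : (((h : ℕ) : ℤ) : ZMod (P.sitesPerDir j)) = 0 := by
      have := sub_eq_zero.mpr hc; push_cast at this ⊢; linear_combination this
    have hne : (((h : ℕ) : ℤ)) ≠ 0 := by omega
    have hlt : (((h : ℕ) : ℤ)).natAbs < P.sitesPerDir j := by omega
    exact intCast_ne_zero_of_natAbs_lt hne hlt hc'
  rw [H1, one_mul, H3, H4, mul_one, mul_one]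
  -- piece 2: the transported segment `[x, x′′]`
  by_cases hcar : ∀ κ, κ ≠ μ0 → (r κ : ℕ) = 0
  · rw [if_pos hcar]
    -- on the axis of the twisted bond: `x = x′ − a e_{μ₀}` with `a = h − n_{μ₀}`
    have ha0 : 0 ≤ (h : ℤ) - n μ0 := by have := (hnb μ0).2; omega
    set a : ℕ := ((h : ℤ) - n μ0).toNat with hadef
    have ha : ((a : ℕ) : ℤ) = (h : ℤ) - n μ0 := Int.toNat_of_nonneg ha0
    have haL : a < P.L := by have := (hnb μ0).1; omega
    refine holAt_single_segment (by omega) x' μ0 g haL x ?_ (fun κ hκ => ?_)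
    · rw [hx, hx0]
      have : ((a : ℕ) : ZMod (P.sitesPerDir j)) = (((h : ℤ) - n μ0 : ℤ) : ZMod (P.sitesPerDir j)) := by
        rw [← ha, Int.cast_natCast]
      rw [this]; push_cast; ring
    · rw [hx, ← hxκ κ hκ]
      have hnκ : n κ = -(h : ℤ) := by
        show off r κ = _
        simp only [off, hcar κ hκ, CharP.cast_eq_zero, zero_sub, hh]
      rw [hnκ]; push_cast; ring
  · rw [if_neg hcar]
    push Not at hcar
    obtain ⟨κ₂, hκ₂, hr⟩ := hcar
    -- off the axis: the transverse coordinate `κ₂` of the segment is `emb y₁ κ₂ + n κ₂ ≠ emb y₁ κ₂ − h`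
    refine holAt_single_eq_one_of_ne_tgt x' μ0 g _ _ (fun k heq => ?_)
    have hc := congrFun heq κ₂
    rw [walkEnd_take_replicate_apply, if_neg (Ne.symm hκ₂), add_zero, hx, Site.shift_apply, if_neg hκ₂, ← hxκ κ₂ hκ₂] at hc
    have hc' : (((n κ₂ : ℤ) + h : ℤ) : ZMod (P.sitesPerDir j)) = 0 := by
      have := sub_eq_zero.mpr hc; push_cast at this ⊢; linear_combination this
    have hnκ : n κ₂ + h ≠ 0 := by
      intro h0
      apply hr
      have : ((r κ₂ : ℕ) : ℤ) = 0 := by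
        have e1 : n κ₂ = ((r κ₂ : ℕ) : ℤ) - h := rfl
        omega
      exact_mod_cast this
    have hb' := hnb κ₂
    have hlt : (((n κ₂ : ℤ) + h : ℤ)).natAbs < P.sitesPerDir j := by omega
    exact intCast_ne_zero_of_natAbs_lt hnκ hlt hc'

/-- The straight transporter `U(c⋆)` runs on the central axis of the two blocks and misses the twisted bond (transverse coordinate). [cite: Balaban1984PropagatorsI, (1.7) p.18 (bookkeeping)] -/
theorem axialAvg_single_star (hper : 2 * P.L < P.sitesPerDir j) (hL : 3 ≤ P.L) {κ₁ μ0 : Fin P.d} (hκ₁ : κ₁ ≠ μ0) (y₁ : Site P (j + 1))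
    (x' : Site P j) (g : G) (hxκ : ∀ κ, κ ≠ μ0 → x' κ + (((P.L - 1) / 2 : ℕ) : ZMod (P.sitesPerDir j)) = emb y₁ κ) :
    AveragingRT.axialAvg (fun b : PBond P j => if b.src = x' ∧ b.dir = μ0 then g else 1) ⟨y₁, μ0⟩ = 1 := by
  set h : ℕ := (P.L - 1) / 2 with hh
  have hL2 : 2 * h + 1 = P.L := AveragingRT.two_mul_half_add_one P
  rw [axialAvg_eq_holAt_walk]
  refine holAt_single_eq_one_of_ne_tgt x' μ0 g _ _ (fun k heq => ?_)
  have hc := congrFun heq κ₁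
  rw [walkEnd_take_replicate_apply] at hc
  simp only at hc
  rw [if_neg (Ne.symm hκ₁), add_zero, Site.shift_apply, if_neg hκ₁, ← hxκ κ₁ hκ₁] at hc
  have hc' : (((h : ℕ) : ℤ) : ZMod (P.sitesPerDir j)) = 0 := by
    have := sub_eq_zero.mpr hc; push_cast at this ⊢; linear_combination this
  exact intCast_ne_zero_of_natAbs_lt (by omega) (by omega) hc'

end Star

/-! ## §4  The printed inner average `exp[mean log]` of a family taking the value `g` on a fraction `|S|/|I|` of the indices and `1` elsewhere -/
section EML

open ExpMeanLog (eml deltaSU expMeanLogSU deltaSU_pos lt_third_of_lt_deltaSU)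
open BlockAveragingEMLAnalyticMean (coe_expMeanLogSU_E_eq_eml eml_eq_exp_meanCLM)
open B7TransferAnalyticMean (meanCLM meanCLM_apply norm_exp_sub_one_le)
open MatrixLog (mlog mlog_one norm_mlog_le_neg_log)

variable {N : ℕ} [NeZero N]

/-- **`exp[mean log]` OF A TWO-VALUED FAMILY**: if `W_i = 1` off a set `S` of indices and `W_i ∈ {1, g}` on it, with `|g − 1| ≤ t < δ_N` (`t < 1`), then
`|E(W) − 1| ≤ exp((|S|/|I|)·(−log(1 − t))) − 1` — the printed operation of (0.4) with the series logarithm (26): `‖log W_i‖ ≤ −log(1 − ‖W_i − 1‖)` on `S`,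
`log 1 = 0` off it, `‖exp Z − 1‖ ≤ e^{‖Z‖} − 1`. [cite: Balaban1987RG1, (0.4) p.253; Balaban1985Averaging, (26) p.23 (bookkeeping)] -/
theorem dist1_avg_expMeanLogSU_le {ι : Type*} [Fintype ι] [Nonempty ι] (W : ι → Matrix.specialUnitaryGroup (Fin N) ℂ) (S : Finset ι)
    (g : Matrix.specialUnitaryGroup (Fin N) ℂ) {t : ℝ} (hW : ∀ i, i ∉ S → W i = 1) (hWS : ∀ i, i ∈ S → W i = 1 ∨ W i = g)
    (hg : dist1 g ≤ t) (htδ : t < deltaSU (Fin N)) (ht1 : t < 1) :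
    dist1 ((expMeanLogSU (n := Fin N)).avg W) ≤ Real.exp ((S.card : ℝ) / Fintype.card ι * (-Real.log (1 - t))) - 1 := by
  classical
  have hall : ∀ i, W i = 1 ∨ W i = g := fun i => if h : i ∈ S then hWS i h else Or.inl (hW i h)
  have hsm : ∀ i, dist1 (W i) < deltaSU (Fin N) := by
    intro i
    rcases hall i with h | h
    · rw [h, GaugeGroup.dist1_one]; exact deltaSU_pos
    · rw [h]; exact hg.trans_lt htδ
  set e := LoopAverage.enum ι with he
  set V : Fin (Fintype.card ι - 1 + 1) → Matrix.specialUnitaryGroup (Fin N) ℂ := W ∘ e.symm with hV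
  have hsmV : ∀ k, dist1 (V k) < deltaSU (Fin N) := fun k => hsm _
  show dist1 ((expMeanLogSU (n := Fin N)).E V) ≤ _
  have hdist : dist1 ((expMeanLogSU (n := Fin N)).E V) =
      ‖(((expMeanLogSU (n := Fin N)).E V : Matrix.specialUnitaryGroup (Fin N) ℂ) : Matrix (Fin N) (Fin N) ℂ) - 1‖ := rfl
  rw [hdist, coe_expMeanLogSU_E_eq_eml V hsmV, eml_eq_exp_meanCLM]
  -- the mean of the logarithms
  set ℓ : ℝ := -Real.log (1 - t) with hℓ
  have ht0 : 0 ≤ t := (GaugeGroup.dist1_nonneg g).trans hg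
  have hℓ0 : 0 ≤ ℓ := by
    rw [hℓ, neg_nonneg]
    exact Real.log_nonpos (by linarith) (by linarith)
  have hterm : ∀ i, ‖mlog ((W i : Matrix.specialUnitaryGroup (Fin N) ℂ) : Matrix (Fin N) (Fin N) ℂ)‖ ≤ if i ∈ S then ℓ else 0 := by
    intro i
    by_cases hi : i ∈ S
    · rw [if_pos hi]
      rcases hall i with h | h
      · rw [h]; simp [hℓ0]
      · rw [h]
        have hg1 : ‖((g : Matrix.specialUnitaryGroup (Fin N) ℂ) : Matrix (Fin N) (Fin N) ℂ) - 1‖ < 1 := (hg.trans_lt ht1 : dist1 g < 1)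
        refine (norm_mlog_le_neg_log hg1).trans ?_
        rw [hℓ, neg_le_neg_iff]
        exact Real.log_le_log (by linarith) (by change 1 - t ≤ 1 - dist1 g; linarith)
    · rw [if_neg hi, hW i hi]; simp
  have hsum : ‖∑ k, mlog ((V k : Matrix.specialUnitaryGroup (Fin N) ℂ) : Matrix (Fin N) (Fin N) ℂ)‖ ≤ S.card * ℓ := by
    have hre : ∑ k, mlog ((V k : Matrix.specialUnitaryGroup (Fin N) ℂ) : Matrix (Fin N) (Fin N) ℂ) =
        ∑ i, mlog ((W i : Matrix.specialUnitaryGroup (Fin N) ℂ) : Matrix (Fin N) (Fin N) ℂ) :=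
      e.symm.sum_comp (fun i => mlog ((W i : Matrix.specialUnitaryGroup (Fin N) ℂ) : Matrix (Fin N) (Fin N) ℂ))
    rw [hre]
    refine (norm_sum_le _ _).trans ?_
    refine (Finset.sum_le_sum fun i _ => hterm i).trans ?_
    rw [Finset.sum_ite_mem, Finset.univ_inter, Finset.sum_const, nsmul_eq_mul]
  have hcard : (Fintype.card (Fin (Fintype.card ι - 1 + 1)) : ℝ) = Fintype.card ι := by
    rw [Fintype.card_fin, Nat.sub_add_cancel Fintype.card_pos]
  have hιpos : (0 : ℝ) < Fintype.card ι := by exact_mod_cast Fintype.card_pos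
  have hmean : ‖meanCLM (Fin (Fintype.card ι - 1 + 1)) (Matrix (Fin N) (Fin N) ℂ)
      (fun k => mlog ((V k : Matrix.specialUnitaryGroup (Fin N) ℂ) : Matrix (Fin N) (Fin N) ℂ))‖ ≤ (S.card : ℝ) / Fintype.card ι * ℓ := by
    rw [meanCLM_apply, norm_smul, norm_inv, Complex.norm_natCast, hcard]
    rw [div_mul_eq_mul_div, le_div_iff₀ hιpos, mul_comm]
    calc (Fintype.card ι : ℝ) * ((Fintype.card ι : ℝ)⁻¹ * ‖∑ k, mlog ((V k : Matrix.specialUnitaryGroup (Fin N) ℂ) : Matrix (Fin N) (Fin N) ℂ)‖)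
        = ‖∑ k, mlog ((V k : Matrix.specialUnitaryGroup (Fin N) ℂ) : Matrix (Fin N) (Fin N) ℂ)‖ := by
          field_simp
      _ ≤ S.card * ℓ := hsum
  refine (norm_exp_sub_one_le _).trans ?_
  gcongr

end EML

end Summit.QuantumFields.YangMills.Theorems.K0AveragedSingleBondFloor

end
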